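import Summits.NavierStokesRegularity.FluidComputer.PalasekTowerLundgrenChildCoreClockNonneg
import Literature.Analysis.SpecialFunctions.GaussianMoments

/-!
# REGISTER v2.3″ (continued): THE GAUSSIAN HAND-OVER — the hand-over entropy in closed form
# `H₀ = Γ·(ac − 1 − log(ac))` and the core clock of a Gaussian-seeded Lundgren child as a NUMBER
# (`λA_k s ≥ log(1600·x_k)`; tuned, level `0`, `λ = 1`: thirteen strain times)

Cell `ns-blowup`, seat `ns-blowup-ecbridge-8` (g10); evidence toward crux stmt-NavierStokesRegularity-20305
`HeredityFromTwoT` (standing record 19250), floor `CoreFloorAt k`, MODEL lane «child core = cross-section of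
Lundgren's stretched flow in the host strain `c = λA_k` at `ν = 1`». Calibration sequel of
`PalasekTowerLundgrenChildCoreClockNonneg` (the co-signed log clock `3200·H₀ ≤ Γ·e^{λA_k s}`): the refuter's
rider K197 R1 priced the clock at the tuned rates for a GAUSSIAN hand-over («`H₀/Γ = KL ≈ 131`, 12.9–13.8 strain
times»); this file puts that arithmetic in the kernel.

* §1 (namespace `CoreClock`): the planar heat Gaussian `g_a = Γ/(4πa)·e^{−‖η‖²/(4a)}` has mass `Γ`, second moment
  `∫‖η‖²g_a = 4Γa`, and **relative entropy `∫ g_a log(g_a/g_b) = Γ·(a/b − 1 − log(a/b))`** with respect to the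
  equal-mass Gaussian `g_b` (Mathlib's `GaussianFourier.integral_rexp_neg_mul_sq_norm` and the tree's
  `Literature.Analysis.SpecialFunctions.integral_norm_sq_mul_exp_neg_mul_sq_norm`).
* §2 `palasekTowerBreakdown_gaussianHandover_child_coreClause_logClock` — the co-signed log clock for a child
  whose hand-over cross-section IS `g_a` (any rates, any `λ` with `x_k ≥ 1.95`): the Lundgren Gaussian at the
  hand-over is `g_{c⁻¹}`, so `H₀ = Γ·(ac − 1 − log(ac))` and the clock reads
  **`3200·(ac − 1 − log(ac)) ≤ e^{λA_k s}`** — no entropy hypothesis left.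
* §3 the LEDGER-WIDTH hand-over `a = 1/(2N_{k+1}²)` (standard deviation = the core-ledger radius `1/N_{k+1}`;
  `ac = x_k/2`): `…_ledgerGaussian_child_coreClause_logClock` — **`1600·x_k ≤ e^{λA_k s}` suffices**
  (`r − 1 − log r ≤ r` for `r ≥ e⁻¹`); and the tuned level-`0` number
  `…_ledgerGaussian_child_coreClause_tuned_zero`: at `TowerRates.tuned`, `k = 0`, `λ = 1`
  (`x₀ = 2^{81/10} < 274.4`, `1600·x₀ < 439 040 < 2.718¹³ < e^{13}`): **`A₀ s ≥ 13` and `Γ ≥ 0.86·c₁N₁^{β−2}`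
  ⇒ the level-`1` core clause** — thirteen of the `169.8` strain times of window `0`
  (`PalasekTowerFaceNumbersTuned.tuned_window_strain_bounds`), K197's «12.9» rounded up.

WHAT THIS IS NOT: not NS about registered flows; no registered Stage; the Gaussian-seeded child is the Burgers
child with a relaxing width, for which `PalasekTowerChildCoreLedgerStokes` already gives the clause at the
Burgers width with no clock — the point here is only to CALIBRATE the co-signed clock's constant on the one
hand-over whose entropy is explicit; the vacuity of the register stands and is not used.

## References
* [cite: GallayWayne2005, Lemma 3.2 and §3.4 (arXiv:math/0402449 pp. 11, 14)]
* [cite: GradshteynRyzhik2015, 3.326.2 with 4.642] · [cite: Palasek2026ElementaryModel, §3 (3.2), §3.1]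
-/

noncomputable section

namespace Summit.NavierStokesRegularity.FluidComputer.PalasekTowerClayBridge

open Real Set MeasureTheory Function
open scoped RealInnerProductSpace ContDiff
open Literature.Analysis.FluidPDE Literature.Analysis.FluidPDE.Lundgren Literature.Analysis.Calculus
open CoreLedgerStokes CoreClock

variable {S S' : Set ℝ}
  {v : ℝ → EuclideanSpace ℝ (Fin 2) → EuclideanSpace ℝ (Fin 2)}
  {q : ℝ → EuclideanSpace ℝ (Fin 2) → ℝ} {w : ℝ → EuclideanSpace ℝ (Fin 2) → ℝ}

/-! ### §1 Planar heat Gaussians: mass, second moment, relative entropy -/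

namespace CoreClock

/-- The planar heat Gaussian `Γ/(4πa)·e^{−‖η‖²/(4a)}` (`a > 0`) is integrable. [folklore] -/
theorem integrable_heatGaussian {a : ℝ} (ha : 0 < a) (Γ : ℝ) :
    Integrable (fun η : EuclideanSpace ℝ (Fin 2) => Γ / (4 * π * a) * exp (-(‖η‖ ^ 2 / (4 * a))))
      (volume : Measure (EuclideanSpace ℝ (Fin 2))) := by
  have h := (integrable_exp_neg_mul_norm_sq (b := 1 / (4 * a)) (by positivity)).const_mul (Γ / (4 * π * a))
  refine h.congr (Filter.Eventually.of_forall fun η => ?_)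
  simp only
  rw [show -(1 / (4 * a) * ‖η‖ ^ 2) = -(‖η‖ ^ 2 / (4 * a)) by ring]

/-- **Mass of the planar heat Gaussian**: `∫ Γ/(4πa)·e^{−‖η‖²/(4a)} dη = Γ` (`a > 0`;
`∫_{ℝ²} e^{−b‖η‖²} = π/b`). [folklore] -/
theorem integral_heatGaussian {a : ℝ} (ha : 0 < a) (Γ : ℝ) :
    ∫ η : EuclideanSpace ℝ (Fin 2), Γ / (4 * π * a) * exp (-(‖η‖ ^ 2 / (4 * a))) = Γ := by
  have hb : 0 < 1 / (4 * a) := by positivity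
  have hmass := GaussianFourier.integral_rexp_neg_mul_sq_norm (V := EuclideanSpace ℝ (Fin 2)) hb
  have hexp : ((Module.finrank ℝ (EuclideanSpace ℝ (Fin 2)) : ℝ) / 2) = 1 := by
    rw [finrank_euclideanSpace_fin]; norm_num
  rw [hexp, Real.rpow_one] at hmass
  have e : (fun η : EuclideanSpace ℝ (Fin 2) => exp (-(‖η‖ ^ 2 / (4 * a)))) =
      fun η => exp (-(1 / (4 * a)) * ‖η‖ ^ 2) := by
    funext η; congr 1; ring
  rw [integral_const_mul, e, hmass]
  field_simp

/-- **Second moment of the planar heat Gaussian**: `∫ ‖η‖²·Γ/(4πa)·e^{−‖η‖²/(4a)} dη = 4Γa`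
(`∫_{ℝ²} ‖η‖²e^{−b‖η‖²} = π/b²`). [cite: GradshteynRyzhik2015, 3.326.2 with 4.642] -/
theorem integral_norm_sq_mul_heatGaussian {a : ℝ} (ha : 0 < a) (Γ : ℝ) :
    ∫ η : EuclideanSpace ℝ (Fin 2), ‖η‖ ^ 2 * (Γ / (4 * π * a) * exp (-(‖η‖ ^ 2 / (4 * a)))) =
      4 * Γ * a := by
  have hb : 0 < 1 / (4 * a) := by positivity
  have h2 := Literature.Analysis.SpecialFunctions.integral_norm_sq_mul_exp_neg_mul_sq_norm
    (V := EuclideanSpace ℝ (Fin 2)) hb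
  have hexp : ((Module.finrank ℝ (EuclideanSpace ℝ (Fin 2)) : ℝ) / 2) = 1 := by
    rw [finrank_euclideanSpace_fin]; norm_num
  rw [hexp, Real.rpow_one, finrank_euclideanSpace_fin] at h2
  have e : (fun η : EuclideanSpace ℝ (Fin 2) => ‖η‖ ^ 2 * (Γ / (4 * π * a) * exp (-(‖η‖ ^ 2 / (4 * a))))) =
      fun η => Γ / (4 * π * a) * (‖η‖ ^ 2 * exp (-(1 / (4 * a)) * ‖η‖ ^ 2)) := by
    funext η
    rw [show -(‖η‖ ^ 2 / (4 * a)) = -(1 / (4 * a)) * ‖η‖ ^ 2 by ring]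
    ring
  rw [e, integral_const_mul, h2]
  push_cast
  field_simp

/-- `‖η‖²·g_a(η)` is integrable. [cite: GradshteynRyzhik2015, 3.326.2 with 4.642] -/
theorem integrable_norm_sq_mul_heatGaussian {a : ℝ} (ha : 0 < a) (Γ : ℝ) :
    Integrable (fun η : EuclideanSpace ℝ (Fin 2) => ‖η‖ ^ 2 * (Γ / (4 * π * a) * exp (-(‖η‖ ^ 2 / (4 * a)))))
      (volume : Measure (EuclideanSpace ℝ (Fin 2))) := by
  have hb : 0 < 1 / (4 * a) := by positivity
  have h := (Literature.Analysis.SpecialFunctions.integrable_norm_pow_mul_exp_neg_mul_sq_norm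
    (V := EuclideanSpace ℝ (Fin 2)) hb 2).const_mul (Γ / (4 * π * a))
  refine h.congr (Filter.Eventually.of_forall fun η => ?_)
  simp only
  rw [show -(1 / (4 * a)) * ‖η‖ ^ 2 = -(‖η‖ ^ 2 / (4 * a)) by ring]
  ring

/-- **Relative entropy of two planar heat Gaussians of equal mass** (`a, b, Γ > 0`):
`∫ g_a log(g_a/g_b) = Γ·(a/b − 1 − log(a/b))`, `g_a = Γ/(4πa)·e^{−‖η‖²/(4a)}` — pointwise
`log(g_a/g_b) = log(b/a) + ‖η‖²(1/(4b) − 1/(4a))`, then mass and second moment. (The Kullback–Leibler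
divergence of two centred isotropic planar Gaussians; `r − 1 − log r ≥ 0`.) [folklore] -/
theorem integral_heatGaussian_mul_log_div {a b Γ : ℝ} (ha : 0 < a) (hb : 0 < b) (hΓ : 0 < Γ) :
    ∫ η : EuclideanSpace ℝ (Fin 2), Γ / (4 * π * a) * exp (-(‖η‖ ^ 2 / (4 * a))) *
        Real.log (Γ / (4 * π * a) * exp (-(‖η‖ ^ 2 / (4 * a))) /
          (Γ / (4 * π * b) * exp (-(‖η‖ ^ 2 / (4 * b))))) = Γ * (a / b - 1 - Real.log (a / b)) := by
  have hA : 0 < Γ / (4 * π * a) := by positivity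
  have hB : 0 < Γ / (4 * π * b) := by positivity
  have hlog : Real.log (Γ / (4 * π * a)) - Real.log (Γ / (4 * π * b)) = Real.log (b / a) := by
    rw [← Real.log_div hA.ne' hB.ne']
    congr 1
    field_simp
  have hpt : ∀ η : EuclideanSpace ℝ (Fin 2),
      Real.log (Γ / (4 * π * a) * exp (-(‖η‖ ^ 2 / (4 * a))) /
          (Γ / (4 * π * b) * exp (-(‖η‖ ^ 2 / (4 * b))))) =
        Real.log (b / a) + ‖η‖ ^ 2 * (1 / (4 * b) - 1 / (4 * a)) := by
    intro η
    rw [Real.log_div (mul_pos hA (exp_pos _)).ne' (mul_pos hB (exp_pos _)).ne',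
      Real.log_mul hA.ne' (exp_pos _).ne', Real.log_mul hB.ne' (exp_pos _).ne', Real.log_exp, Real.log_exp,
      ← hlog]
    ring
  have e : (fun η : EuclideanSpace ℝ (Fin 2) => Γ / (4 * π * a) * exp (-(‖η‖ ^ 2 / (4 * a))) *
      Real.log (Γ / (4 * π * a) * exp (-(‖η‖ ^ 2 / (4 * a))) /
        (Γ / (4 * π * b) * exp (-(‖η‖ ^ 2 / (4 * b)))))) =
      fun η => Real.log (b / a) * (Γ / (4 * π * a) * exp (-(‖η‖ ^ 2 / (4 * a)))) +
        (1 / (4 * b) - 1 / (4 * a)) * (‖η‖ ^ 2 * (Γ / (4 * π * a) * exp (-(‖η‖ ^ 2 / (4 * a))))) := by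
    funext η; rw [hpt η]; ring
  rw [e, integral_add ((integrable_heatGaussian ha Γ).const_mul _)
      ((integrable_norm_sq_mul_heatGaussian ha Γ).const_mul _),
    integral_const_mul (Real.log (b / a)), integral_const_mul (1 / (4 * b) - 1 / (4 * a)), integral_heatGaussian ha,
    integral_norm_sq_mul_heatGaussian ha, Real.log_div hb.ne' ha.ne', Real.log_div ha.ne' hb.ne']
  field_simp
  ring

/-- `r − 1 − log r ≤ r` once `r ≥ e⁻¹` (here from `2r ≥ 1.95`). [folklore] -/
theorem sub_one_sub_log_le_self {r : ℝ} (hr : 1.95 ≤ 2 * r) : r - 1 - Real.log r ≤ r := by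
  have hr0 : 0 < r := by linarith
  have h1 : Real.log (exp (-1)) ≤ Real.log r := by
    refine Real.log_le_log (exp_pos _) ?_
    have := CoreClock.exp_neg_le_of_four_le (le_refl (4 : ℝ))
    have h4 : exp (-1) ≤ 0.37 := by
      rw [Real.exp_neg, inv_le_comm₀ (exp_pos _) (by norm_num)]
      have he : (2.7182818283 : ℝ) < exp 1 := Real.exp_one_gt_d9
      linarith
    linarith
  rw [Real.log_exp] at h1
  linarith

end CoreClock

/-! ### §2 The Gaussian hand-over: the log clock with the entropy in closed form -/

/-- **THE CORE CLOCK OF A GAUSSIAN-SEEDED CHILD** (any rates `R`, any schedule, any level `k`, any `λ > 0`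
with `x_k = λN_k^{β−2b} ≥ 1.95`; the co-signed setting of `…_cosigned_child_coreClause_logClock` with the
hand-over cross-section EQUAL to the heat Gaussian `ω̃(0) = Γ/(4πa)·e^{−‖η‖²/(4a)}`, `a, Γ > 0`): the
hand-over entropy relative to the Lundgren Gaussian `g_{c⁻¹}` (`c = λA_k`) is `H₀ = Γ·(ac − 1 − log(ac))`, so
**`3200·(ac − 1 − log(ac)) ≤ e^{λA_k s}` and `Γ ≥ 0.86·c₁N_{k+1}^{β−2}` ⇒ the level-`(k+1)` core clause at
strain time `s`** on every cross-section `{x₂ = z₀}`, `|z₀| ≤ radius`. MODEL statement; not about any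
registered flow. [cite: GallayWayne2005, Lemma 3.2 and §3.4; Palasek2026ElementaryModel, §3.1] -/
theorem palasekTowerBreakdown_gaussianHandover_child_coreClause_logClock (R : TowerRates) (Sch : Schedule R)
    (k : ℕ) {l : ℝ} (hl : 0 < l) (hS' : Convex ℝ S') (hv : IsClassicalNSSolutionOn S' 1 0 v q)
    (hω : HasUniformRapidDecayOn S' (fun σ η => PlanarEigenmode.vorticity (v σ) η))
    (hBS : ∀ σ ∈ S', ∀ η, v σ η = biotSavart2D (PlanarEigenmode.vorticity (v σ)) η)
    {a Γ : ℝ} (ha : 0 < a) (hΓ : 0 < Γ)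
    (hinit : ∀ η, PlanarEigenmode.vorticity (v 0) η = Γ / (4 * π * a) * exp (-(‖η‖ ^ 2 / (4 * a))))
    (hw : IsSmoothSpaceTimeOn S' w)
    (hmaps : MapsTo (fun t => (exp (l * R.A k * t) - 1) / (l * R.A k)) S S')
    (h0 : (0 : ℝ) ∈ S') {s : ℝ} (hsS : s ∈ S) (hs : 0 ≤ s) {z₀ : ℝ} (hz₀ : |z₀| ≤ Sch.radius)
    (hx : 1.95 ≤ l * R.N k ^ (R.β - 2 * R.b))
    (hclock : 3200 * (a * (l * R.A k) - 1 - Real.log (a * (l * R.A k))) ≤ exp (l * R.A k * s))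
    (hC : 0.86 * Sch.c₁ * R.N (k + 1) ^ (R.β - 2) ≤ Γ) :
    ∃ (x' : EuclideanSpace ℝ (Fin 3)) (γ : ℝ → EuclideanSpace ℝ (Fin 3)),
      ‖x'‖ ≤ Sch.radius ∧ ContDiff ℝ 1 γ ∧ γ 0 = γ 1 ∧
      (∀ σ ∈ Icc (0 : ℝ) 1, γ σ ∈ Metric.closedBall x' (1 / R.N (k + 1))) ∧
      (∀ σ ∈ Icc (0 : ℝ) 1, ‖deriv γ σ‖ ≤ 8 * π / R.N (k + 1)) ∧
      Sch.c₁ * R.N (k + 1) ^ (R.β - 2) ≤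
        circulation (velocity (fun _ => l * R.A k)
          (fun t y => exp (l * R.A k * t / 2) •
            v ((exp (l * R.A k * t) - 1) / (l * R.A k)) (exp (l * R.A k * t / 2) • y))
          (fun t y => exp (-(l * R.A k * t)) •
            w ((exp (l * R.A k * t) - 1) / (l * R.A k)) (exp (l * R.A k * t / 2) • y)) s) γ := by
  set c : ℝ := l * R.A k with hc
  have hcpos : 0 < c := mul_pos hl (R.A_pos k)
  have hfun : PlanarEigenmode.vorticity (v 0) = fun η => Γ / (4 * π * a) * exp (-(‖η‖ ^ 2 / (4 * a))) :=
    funext hinit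
  have hint : ∫ y, PlanarEigenmode.vorticity (v 0) y = Γ := by
    rw [hfun]; exact integral_heatGaussian ha Γ
  have h0nn : ∀ η, 0 ≤ PlanarEigenmode.vorticity (v 0) η := fun η => by rw [hinit η]; positivity
  have hΓ' : 0 < ∫ y, PlanarEigenmode.vorticity (v 0) y := by rw [hint]; exact hΓ
  have hH₀ : ∫ η, PlanarEigenmode.vorticity (v 0) η *
      Real.log (PlanarEigenmode.vorticity (v 0) η /
        ((∫ y, PlanarEigenmode.vorticity (v 0) y) / (4 * π * c⁻¹) * exp (-(‖η‖ ^ 2 / (4 * c⁻¹))))) =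
      Γ * (a * c - 1 - Real.log (a * c)) := by
    rw [hint]
    simp only [hinit]
    rw [integral_heatGaussian_mul_log_div ha (inv_pos.2 hcpos) hΓ, div_inv_eq_mul]
  refine palasekTowerBreakdown_cosigned_child_coreClause_logClock R Sch k hl hS' hv hω hBS h0nn hΓ' hw hmaps h0
    hsS hs hz₀ hx ?_ ?_
  · rw [hH₀, hint]
    have := mul_le_mul_of_nonneg_left hclock hΓ.le
    linarith
  · rw [hint]; exact hC

/-! ### §3 The ledger-width Gaussian hand-over; the tuned level-`0` number -/

/-- **THE LEDGER-WIDTH GAUSSIAN HAND-OVER** (same setting, the hand-over Gaussian of heat age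
`a = 1/(2N_{k+1}²)`, i.e. standard deviation equal to the core-ledger radius `1/N_{k+1}`; then `ac = x_k/2` and
`H₀/Γ = x_k/2 − 1 − log(x_k/2) ≤ x_k/2`): **`1600·x_k ≤ e^{λA_k s}` and `Γ ≥ 0.86·c₁N_{k+1}^{β−2}` ⇒ the
level-`(k+1)` core clause at strain time `s`** (`x_k = λN_k^{β−2b} ≥ 1.95`). MODEL statement.
[cite: GallayWayne2005, Lemma 3.2 and §3.4; Palasek2026ElementaryModel, §3.1] -/
theorem palasekTowerBreakdown_ledgerGaussian_child_coreClause_logClock (R : TowerRates) (Sch : Schedule R)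
    (k : ℕ) {l : ℝ} (hl : 0 < l) (hS' : Convex ℝ S') (hv : IsClassicalNSSolutionOn S' 1 0 v q)
    (hω : HasUniformRapidDecayOn S' (fun σ η => PlanarEigenmode.vorticity (v σ) η))
    (hBS : ∀ σ ∈ S', ∀ η, v σ η = biotSavart2D (PlanarEigenmode.vorticity (v σ)) η)
    {Γ : ℝ} (hΓ : 0 < Γ)
    (hinit : ∀ η, PlanarEigenmode.vorticity (v 0) η =
      Γ / (4 * π * (1 / (2 * R.N (k + 1) ^ 2))) * exp (-(‖η‖ ^ 2 / (4 * (1 / (2 * R.N (k + 1) ^ 2))))))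
    (hw : IsSmoothSpaceTimeOn S' w)
    (hmaps : MapsTo (fun t => (exp (l * R.A k * t) - 1) / (l * R.A k)) S S')
    (h0 : (0 : ℝ) ∈ S') {s : ℝ} (hsS : s ∈ S) (hs : 0 ≤ s) {z₀ : ℝ} (hz₀ : |z₀| ≤ Sch.radius)
    (hx : 1.95 ≤ l * R.N k ^ (R.β - 2 * R.b))
    (hclock : 1600 * (l * R.N k ^ (R.β - 2 * R.b)) ≤ exp (l * R.A k * s))
    (hC : 0.86 * Sch.c₁ * R.N (k + 1) ^ (R.β - 2) ≤ Γ) :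
    ∃ (x' : EuclideanSpace ℝ (Fin 3)) (γ : ℝ → EuclideanSpace ℝ (Fin 3)),
      ‖x'‖ ≤ Sch.radius ∧ ContDiff ℝ 1 γ ∧ γ 0 = γ 1 ∧
      (∀ σ ∈ Icc (0 : ℝ) 1, γ σ ∈ Metric.closedBall x' (1 / R.N (k + 1))) ∧
      (∀ σ ∈ Icc (0 : ℝ) 1, ‖deriv γ σ‖ ≤ 8 * π / R.N (k + 1)) ∧
      Sch.c₁ * R.N (k + 1) ^ (R.β - 2) ≤
        circulation (velocity (fun _ => l * R.A k)
          (fun t y => exp (l * R.A k * t / 2) •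
            v ((exp (l * R.A k * t) - 1) / (l * R.A k)) (exp (l * R.A k * t / 2) • y))
          (fun t y => exp (-(l * R.A k * t)) •
            w ((exp (l * R.A k * t) - 1) / (l * R.A k)) (exp (l * R.A k * t / 2) • y)) s) γ := by
  have hN1 := R.N_pos (k + 1)
  have ha : 0 < 1 / (2 * R.N (k + 1) ^ 2) := by positivity
  refine palasekTowerBreakdown_gaussianHandover_child_coreClause_logClock R Sch k hl hS' hv hω hBS ha hΓ hinit
    hw hmaps h0 hsS hs hz₀ hx ?_ hC
  -- `ac = x_k/2`
  have hr : 1 / (2 * R.N (k + 1) ^ 2) * (l * R.A k) = l * R.N k ^ (R.β - 2 * R.b) / 2 := by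
    rw [← palasekTowerBreakdown_coreRatio_eq]; field_simp
  rw [hr]
  have hle := CoreClock.sub_one_sub_log_le_self (r := l * R.N k ^ (R.β - 2 * R.b) / 2) (by linarith)
  linarith

/-- **THIRTEEN STRAIN TIMES AT THE TUNED RATES** (`TowerRates.tuned = (2^24, 33/32, 12/5, 49/20)`, level
`k = 0`, `λ = 1`, any schedule; the ledger-width Gaussian hand-over of §3): `x₀ = N₀^{β−2b} = 2^{81/10} < 274.4`,
so `1600·x₀ < 439 040 < 2.718¹³ < e^{13}`; hence **`A₀ s ≥ 13` and `Γ ≥ 0.86·c₁N₁^{β−2}` ⇒ the Gaussian-seeded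
child meets the level-`1` core clause at strain time `s`** on every cross-section `{x₂ = z₀}`, `|z₀| ≤ radius`
— thirteen of the `4b²β log N₀ ∈ (169.8, 169.9)` strain times of window `0`. MODEL statement; not about any
registered flow. [cite: GallayWayne2005, Lemma 3.2 and §3.4; Palasek2026ElementaryModel, §3 (3.2), §3.1] -/
theorem palasekTowerBreakdown_ledgerGaussian_child_coreClause_tuned_zero (Sch : Schedule TowerRates.tuned)
    (hS' : Convex ℝ S') (hv : IsClassicalNSSolutionOn S' 1 0 v q)
    (hω : HasUniformRapidDecayOn S' (fun σ η => PlanarEigenmode.vorticity (v σ) η))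
    (hBS : ∀ σ ∈ S', ∀ η, v σ η = biotSavart2D (PlanarEigenmode.vorticity (v σ)) η)
    {Γ : ℝ} (hΓ : 0 < Γ)
    (hinit : ∀ η, PlanarEigenmode.vorticity (v 0) η =
      Γ / (4 * π * (1 / (2 * TowerRates.tuned.N (0 + 1) ^ 2))) *
        exp (-(‖η‖ ^ 2 / (4 * (1 / (2 * TowerRates.tuned.N (0 + 1) ^ 2))))))
    (hw : IsSmoothSpaceTimeOn S' w)
    (hmaps : MapsTo (fun t => (exp (1 * TowerRates.tuned.A 0 * t) - 1) / (1 * TowerRates.tuned.A 0)) S S')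
    (h0 : (0 : ℝ) ∈ S') {s : ℝ} (hsS : s ∈ S) (hs13 : 13 ≤ TowerRates.tuned.A 0 * s) {z₀ : ℝ}
    (hz₀ : |z₀| ≤ Sch.radius)
    (hC : 0.86 * Sch.c₁ * TowerRates.tuned.N (0 + 1) ^ (TowerRates.tuned.β - 2) ≤ Γ) :
    ∃ (x' : EuclideanSpace ℝ (Fin 3)) (γ : ℝ → EuclideanSpace ℝ (Fin 3)),
      ‖x'‖ ≤ Sch.radius ∧ ContDiff ℝ 1 γ ∧ γ 0 = γ 1 ∧
      (∀ σ ∈ Icc (0 : ℝ) 1, γ σ ∈ Metric.closedBall x' (1 / TowerRates.tuned.N (0 + 1))) ∧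
      (∀ σ ∈ Icc (0 : ℝ) 1, ‖deriv γ σ‖ ≤ 8 * π / TowerRates.tuned.N (0 + 1)) ∧
      Sch.c₁ * TowerRates.tuned.N (0 + 1) ^ (TowerRates.tuned.β - 2) ≤
        circulation (velocity (fun _ => 1 * TowerRates.tuned.A 0)
          (fun t y => exp (1 * TowerRates.tuned.A 0 * t / 2) •
            v ((exp (1 * TowerRates.tuned.A 0 * t) - 1) / (1 * TowerRates.tuned.A 0))
              (exp (1 * TowerRates.tuned.A 0 * t / 2) • y))
          (fun t y => exp (-(1 * TowerRates.tuned.A 0 * t)) •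
            w ((exp (1 * TowerRates.tuned.A 0 * t) - 1) / (1 * TowerRates.tuned.A 0))
              (exp (1 * TowerRates.tuned.A 0 * t / 2) • y)) s) γ := by
  have hA := TowerRates.tuned.A_pos 0
  have hs : 0 ≤ s := by nlinarith
  -- `x₀ = 2^{81/10} ∈ [256, 274.4)`
  have hx0 : 1 * TowerRates.tuned.N 0 ^ (TowerRates.tuned.β - 2 * TowerRates.tuned.b) =
      (2 : ℝ) ^ ((81 : ℝ) / 10) := by
    rw [one_mul, TowerRates.tuned_N_eq_two_rpow, ← Real.rpow_mul (by norm_num : (0 : ℝ) ≤ 2)]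
    simp only [TowerRates.tuned, pow_zero, mul_one]
    norm_num
  have hxlt : (2 : ℝ) ^ ((81 : ℝ) / 10) < 274.4 := by
    have hp : ((2 : ℝ) ^ ((81 : ℝ) / 10)) ^ (10 : ℕ) = 2 ^ (81 : ℕ) := by
      rw [← Real.rpow_natCast, ← Real.rpow_mul (by norm_num : (0 : ℝ) ≤ 2)]
      norm_num
    refine lt_of_pow_lt_pow_left₀ 10 (by norm_num) ?_
    rw [hp]; norm_num
  have hx : 1.95 ≤ 1 * TowerRates.tuned.N 0 ^ (TowerRates.tuned.β - 2 * TowerRates.tuned.b) := by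
    have := TowerRates.tuned_coreRatio_ge 0
    linarith
  -- `e^{13} > 2.718^{13} > 439 040`
  have hexp : (439040 : ℝ) < exp (1 * TowerRates.tuned.A 0 * s) := by
    have h13 : exp 13 ≤ exp (1 * TowerRates.tuned.A 0 * s) := exp_le_exp.2 (by linarith)
    have he : (2.7182818283 : ℝ) < exp 1 := Real.exp_one_gt_d9
    have hpow : (2.718 : ℝ) ^ 13 < exp 1 ^ 13 := by
      exact pow_lt_pow_left₀ (by linarith) (by norm_num) (by norm_num)
    have h13' : exp 13 = exp 1 ^ 13 := by rw [← Real.exp_nat_mul]; norm_num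
    have hnum : (439040 : ℝ) < (2.718 : ℝ) ^ 13 := by norm_num
    linarith
  refine palasekTowerBreakdown_ledgerGaussian_child_coreClause_logClock TowerRates.tuned Sch 0 one_pos hS' hv
    hω hBS hΓ hinit hw hmaps h0 hsS hs hz₀ hx ?_ hC
  rw [hx0]
  linarith

end Summit.NavierStokesRegularity.FluidComputer.PalasekTowerClayBridge
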